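import Summits.BirchSwinnertonDyer.Rank1Residual.X11b.KolyvaginHlocConcrete
import Summits.BirchSwinnertonDyer.BirchSwinnertonDyer.Theorems.KolyvaginRoadThreePointCertificate
import Summits.BirchSwinnertonDyer.BirchSwinnertonDyer.Theorems.KolyvaginRoadThreeLevelData
import Summits.BirchSwinnertonDyer.BirchSwinnertonDyer.Theorems.Rank1ResidualJetSignedGlobalDualityPlus
import Summits.BirchSwinnertonDyer.Rank1Residual.X11b.KolyvaginHpointsAssembly
import Literature.NumberTheory.EllipticCurves.Jetchev2008.CoreVertices
import HarnessLib

/-!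
# T1 JET (cell `bsd-jet`), road K: Gross 1991 Prop. 6.2 (1) — the concrete Kolyvagin class `c_M(m)` is
# SELMER (Kummer condition) at every place `v ∤ m` — at ZHANG–Kolyvagin levels, modulo [GZ86 III (3.1)];
# the Kummer part of the input `hκsel` of `JET.tamagawaExponent_le_mInfty_of_rowData` (p492296)

HONEST FRAMING (programme file §HONESTY, verbatim): «no tranche here proves BSD; ARM L moves the
LITERAL column of an r ≤ 1 census into the kernel-proved-modulo-named-print column.» THEOREMS ONLY
(seat `bsd-jet-pv-2`, session g3; `--supports stmt-BirchSwinnertonDyer-14418`, helper); 0 classes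
move. WHAT THIS IS. x11b3's `KolyvaginHloc.hloc_concrete_of_GZ31` proves, for a family of concrete
Kolyvagin–Heegner data at the divisors of a square-free top level `n`, that `c_M(m) ∈ Sel_v`
(`selmerLocalKer`, i.e. `c_M(m)` dies in `H¹(K_v, E)`) at EVERY finite place `v ∤ m` — good `v` by
Milne ADT I.3.8 (inertia acts trivially, kernel theorem), bad `v` (including `v ∣ p` and `v ∣ N`) by the
`E⁰(K̄_v)`-receptacle form of Gross's proof of Prop. 6.2 (1) from [GZ86 III (3.1)] (*"`y_n` is, up to
translation by rational torsion on `E`, in `E⁰`"*) — the labelled input `hGZ`, cite-only — CONDITIONAL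
also on `hcop` (`n′` prime to `p^M`) and the admissibility `hA`; its top level is in GROSS currency
(`IsKolyvaginPrime ∧ FrobEqFrobInfty (p^M)`). As in the sibling `Rank1ResidualJetKolyvaginClassSign.lean`,
this file RE-RUNS that proof verbatim at ZHANG–Kolyvagin levels (`Zhang2014.IsKolyvaginPrime ∧
M ≤ Zhang2014.kolyvaginIndex`, the currency of the road-K conductors), swapping the three
Frobenius-currency inputs for their Zhang re-typings (`KolyCert.kolyvaginPoint_mem_invPoints_of_dvd_zhang`,
`p^M ∣ ℓ + 1` and `p^M ∣ a_ℓ` from `Zhang2014.le_kolyvaginIndex_iff`):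
* `hloc_concrete_of_GZ31_zhang` — the family form (`c_M(m) ∈ selmerLocalKer` at finite `v ∤ m`);
* `localization_kolyvaginClass_mem_kummerSelmerStructure_of_GZ31` — the Kummer part of `hκsel` in the
  `H63` binder's currency: for ONE conductor `c ∈ Λ_k` and ONE datum `d`, at every place `v` of `K`
  (finite or infinite) NOT over a prime factor of `c`, `loc_v c_k(c) ∈ H¹_Kum(K_v, E[p^k])`
  (`kummerSelmerStructure`, the dictionary `comap_localization_kummerSelmerStructure`; complex places by
  `H¹(ℂ, ·) = 0`, pv-1's `addSubgroup_galoisCohomology_inl_eq_top_of_isComplex`), modulo `hGZ` for all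
  data, `hcop`, and the two Gross §3 CM facts (data at the divisors). What remains of `hκsel` after this
  file: the TRANSVERSE condition at the primes `ℓ ∣ c` (`Jetchev2008.transverseKer`).
References: [cite: GrossLMS1991, §6 Prop. 6.2 (1) and proof (pp. 244–245), Prop. 3.7 (1), §3 (3.3),
Lemma 4.3, §4 (4.1)] [cite: McCallumLMS1991, Lemma 4.3, §4 (4)–(6)] [cite: GrossZagier1986, III (3.1)]
[cite: MilneADT2006, Ch. I Prop. 3.8] [cite: Jetchev2008, §3.3.1/§3.4.1 (H_{𝓕(c)}), Prop. 4.6 (p. 820)].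
-/

set_option autoImplicit false

noncomputable section

open scoped Classical
open WeierstrassCurve Field NumberField IsDedekindDomain Finset
open Literature.NumberTheory.EllipticCurves Literature.NumberTheory.GaloisRepresentations
open Literature.NumberTheory.EllipticCurves.KolyvaginCocycle Literature.NumberTheory.EllipticCurves.KolyvaginEuler
open Literature.NumberTheory.EllipticCurves.RingClassField Literature.NumberTheory.EllipticCurves.ModularForms
open Summit.BirchSwinnertonDyer.Rank1Residual.X11b Summit.BirchSwinnertonDyer.Rank1Residual.X11b.Three
open Summit.BirchSwinnertonDyer.Rank1Residual.X11b.Three.GrossBadPlace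
open Summit.BirchSwinnertonDyer.Rank1Residual.X11b.KolyvaginHloc

namespace Summit.BirchSwinnertonDyer.Rank1Residual.JET

-- `K : Type`: the tree's ring-class class field theory is universe `0`.
variable {K : Type} [Field K] [NumberField K] {N : ℕ} {W : WeierstrassCurve ℚ}

/-- **Gross 1991 Prop. 6.2 (1) for the CONCRETE classes at ZHANG–Kolyvagin levels** (`c_M(m) ∈ Sel_v` at
every finite `v ∤ m`): x11b3's `KolyvaginHloc.hloc_concrete_of_GZ31` VERBATIM with the prime factors of
the top level given as `Zhang2014.IsKolyvaginPrime N W K p q ∧ M ≤ Zhang2014.kolyvaginIndex W p q`; the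
invariance `hPt` from `KolyCert.kolyvaginPoint_mem_invPoints_of_dvd_zhang`, the congruences from
`Zhang2014.le_kolyvaginIndex_iff`. CONDITIONAL on `hGZ` ([GZ86 III (3.1)] in the receptacle form of
Gross's proof, cite-only), `hcop`, `hA`. [cite: GrossLMS1991, §6 Prop. 6.2 (1) and proof, Prop. 3.7 (1),
§3 (3.3), §4 (4.1), Lemma 4.3] [cite: McCallumLMS1991, Lemma 4.3, §4 (4)–(6)]
[cite: GrossZagier1986, III (3.1)] [cite: MilneADT2006, Ch. I Prop. 3.8] -/
theorem hloc_concrete_of_GZ31_zhang [NeZero N] [W.IsElliptic] [W.IsGloballyMinimal]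
    (hK : IsImaginaryQuadratic K) (ι : K →+* ℂ)
    {p M : ℕ} (hp : p.Prime)
    (Dt : ModularParametrizationData W N) {β : ℤ}
    (hND : IsCoprime (N : ℤ) (NumberField.discr K)) (hD : NumberField.discr K < -4)
    {n : ℕ} (hn : Squarefree n)
    (hkol : ∀ q ∈ n.primeFactors,
      Zhang2014.IsKolyvaginPrime N W K p q ∧ M ≤ Zhang2014.kolyvaginIndex W p q)
    (d : (m : ℕ) → m ∣ n → KolyvaginHeegnerData Dt β ι m)
    {n' : ℤ} (hcop : IsCoprime ((p ^ M : ℕ) : ℤ) n')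
    (hGZ : ∀ (m : ℕ) (hm : m ∣ n) (γ : ringClassField K ι m ≃ₐ[ℚ] ringClassField K ι m),
      γ ∈ ringClassGal ι m → ∀ v : HeightOneSpectrum (𝓞 K), ¬ (W.baseChange K).HasGoodReductionAt v →
        n' • pointsMap (W.baseChange K) (v.adicCompletion K)
            ((d m hm).toGeomPoints (pointGalHom W (ringClassField K ι m) γ (d m hm).y)) ∈
          E0Receptacle (W.baseChange K) v ∧
        ∀ (ℓ : ℕ) (hℓ : ℓ ∈ m.primeFactors)
          (hle : ringClassField K ι (m / ℓ) ≤ ringClassField K ι m),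
          n' • pointsMap (W.baseChange K) (v.adicCompletion K)
              ((d m hm).toGeomPoints (pointGalHom W (ringClassField K ι m) γ
                (WeierstrassCurve.Affine.Point.map (W' := W)
                  ((RingClassField.inclusion ι hle).restrictScalars ℚ)
                  (d (m / ℓ) ((Nat.div_dvd_of_dvd (Nat.dvd_of_mem_primeFactors hℓ)).trans hm)).y))) ∈
            E0Receptacle (W.baseChange K) v)
    (hA : ∀ (m : ℕ) (hm : m ∣ n),
      IsAdmissible (absoluteGaloisGroup K) (d m hm).pointsSubgroup ((p ^ M : ℕ) : ℤ)) :
    ∀ (m : ℕ) (hm : m ∣ n) (v : HeightOneSpectrum (𝓞 K)), (m : 𝓞 K) ∉ v.asIdeal →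
      (d m hm).kolyvaginClass hp M ∈
        selmerLocalKer (W.baseChange K) (v.adicCompletion K) ((p ^ M : ℕ) : ℤ) := by
  intro m hm v hmv
  haveI : Fact p.Prime := ⟨hp⟩
  have hn0 : n ≠ 0 := Squarefree.ne_zero hn
  have hm0 : m ≠ 0 := ne_zero_of_dvd_ne_zero hn0 hm
  have hinert : ∀ q ∈ n.primeFactors, (Ideal.span {(q : 𝓞 K)}).IsPrime :=
    fun q hq ↦ (hkol q hq).1.2.2.2.2.1
  have hdiv : ∀ Q : geomPoints (W.baseChange K), ∃ R, ((p ^ M : ℕ) : ℤ) • R = Q :=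
    (W.baseChange K).zsmul_geomPoints_surjective_of_charZero
      (by exact_mod_cast pow_ne_zero M hp.ne_zero)
  -- THE SEAM: level data at every level (x11b3-p2 GEN 7, `exists_levelData`)
  choose σ H f y π j e hord hj hπρ hfsec hHρ hdict hjunk using
    fun k ↦ KolyvaginH44.exists_levelData (W := W) (Dt := Dt) (β := β) hK ι hn hinert d k
  -- `𝒢_m = ringClassGal ι m`, a finite commutative group acting on `E(K[m])` through `pointGalHom`
  letI hcg : ∀ k, CommGroup (ringClassGal ι k) := fun k ↦
    { (inferInstance : Group (ringClassGal ι k)) with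
      mul_comm := fun a b ↦ (KolyvaginH44.isMulCommutative_ringClassGal' hK ι k).is_comm.comm a b }
  haveI hfin : ∀ k, Finite (ringClassGal ι k) := KolyvaginH44.finite_ringClassGal hK ι
  letI act : ∀ k, DistribMulAction (ringClassGal ι k)
      ((W.baseChange (ringClassField K ι k)).toAffine.Point) := fun k ↦
    DistribMulAction.compHom _ ((pointGalHom W (ringClassField K ι k)).comp (ringClassGal ι k).subtype)
  letI hft : ∀ k, Fintype (ringClassGal ι k ⧸ H k) := fun k ↦ Fintype.ofFinite _
  have hsmul : ∀ (k) (g : ringClassGal ι k) (Q : (W.baseChange (ringClassField K ι k)).toAffine.Point),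
      g • Q = pointGalHom W (ringClassField K ι k)
        (g : ringClassField K ι k ≃ₐ[ℚ] ringClassField K ι k) Q := fun _ _ _ ↦ rfl
  -- the inclusion `ρ_m : 𝒢_m ≤ Aut_ℚ(K[m])` (the identity `iA_m` is `AddEquiv.refl`)
  set ρ : ∀ k, ringClassGal ι k →* (ringClassField K ι k ≃ₐ[ℚ] ringClassField K ι k) :=
    fun k ↦ (ringClassGal ι k).subtype with hρdef
  have hρ : ∀ k, Function.Injective (ρ k) := fun k ↦ (ringClassGal ι k).subtype_injective
  have hj' : ∀ (k) (g : absoluteGaloisGroup K)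
      (a : (W.baseChange (ringClassField K ι k)).toAffine.Point),
      j k (π k g • a) = g • j k a := fun k g a ↦ by rw [hsmul]; exact hj k g a
  have hπρ' : ∀ (k) (τ : absoluteGaloisGroup K) (x : ringClassField K ι k),
      τ • e k x = e k (ρ k (π k τ) x) := fun k τ x ↦ hπρ k τ x
  -- the abstract Kolyvagin point IS `P(m)` at the divisors (x11b3-p8's G1)
  have hP : ∀ (k) (hk : k ∣ n),
      j k (kolyvaginPoint (σ k) k.primeFactors (f k) (y k)) =
        (d k hk).toGeomPoints (d k hk).derivedPoint := by
    intro k hk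
    obtain ⟨hjk, hyk, hσk, hfS⟩ := hdict k hk
    rw [hjk, hyk]
    congr 1
    have hbij := KolyvaginH37Bridge.bijOn_of_section_of_transversal (ρ k) (hρ k)
      (H := H k) (Γ := ringClassGal ι k) (G₁ := ringClassGalOver ι k 1) (hHρ k)
      (S := ((d k hk).S : Set _)) (fun s hs ↦ (d k hk).S_subset s hs)
      (fun s hs ↦ ⟨⟨s, (d k hk).S_subset s hs⟩, rfl⟩) (d k hk).S_transversal (f k) (hfsec k) hfS
    exact KolyvaginH37Bridge.map_kolyvaginPoint_eq_derivedPoint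
      (pointGalHom W (ringClassField K ι k)) (ρ k) (AddMonoidHom.id _) (fun g a ↦ hsmul k g a)
      (hn.squarefree_of_dvd hk) hσk (f k) hbij (d k hk).y
  -- the dictionary clauses the abstract ENDs read
  have hyA : ∀ (k : ℕ) (hk : k ∣ n), AddEquiv.refl _ (y k) = (d k hk).y :=
    fun k hk ↦ (hdict k hk).2.1
  have hσA : ∀ (k : ℕ) (hk : k ∣ n), ∀ q ∈ k.primeFactors, ρ k (σ k q) = (d k hk).σ q :=
    fun k hk ↦ (hdict k hk).2.2.1
  -- `hA`, `hPt` (P4-A), `hgen`, `hdvd`, `hI` (P4-B) at level `m`, in ABSTRACT currency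
  have hA' : IsAdmissible (absoluteGaloisGroup K) (j m).range ((p ^ M : ℕ) : ℤ) := by
    rw [(hdict m hm).1]; exact hA m hm
  have hPt' : j m (kolyvaginPoint (σ m) m.primeFactors (f m) (y m)) ∈
      invPoints (absoluteGaloisGroup K) (j m).range ((p ^ M : ℕ) : ℤ) :=
    KolyCert.kolyvaginPoint_mem_invPoints_of_dvd_zhang hK ι Dt hp hND hD hn hkol d σ
      (fun k ↦ k.primeFactors) H f y π j hj' ρ hρ (fun _ ↦ AddEquiv.refl _)
      (fun k _ g a ↦ hsmul k g a) hyA hσA (fun _ _ ↦ rfl) (fun k _ ↦ hfsec k) (fun k _ ↦ hHρ k)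
      m hm
  have hgen : H m ≤ Subgroup.closure (σ m '' (m.primeFactors : Set ℕ)) :=
    KolyvaginH44.le_closure_of_dvd hK ι Dt hn d σ (fun k ↦ k.primeFactors) H ρ hρ hσA
      (fun _ _ ↦ rfl) (fun k _ ↦ hHρ k) m hm
  have hdvd : ∀ ℓ ∈ m.primeFactors, ((p ^ M : ℕ) : ℤ) ∣ ((ℓ + 1 : ℕ) : ℤ) := by
    intro ℓ hℓ
    obtain ⟨-, hℓM⟩ := hkol ℓ (Nat.primeFactors_mono hm hn0 hℓ)
    exact Int.natCast_dvd_natCast.mpr (Zhang2014.le_kolyvaginIndex_iff.mp hℓM).1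
  obtain ⟨𝔐, h𝔐⟩ := v.localPrimesAbove_nonempty
  have hI' : ∀ t ∈ 𝔐.inertia (absoluteGaloisGroup (v.adicCompletion K)),
      resGal (K := K) (v.adicCompletion K) t • j m (kolyvaginPoint (σ m) m.primeFactors (f m) (y m)) =
        j m (kolyvaginPoint (σ m) m.primeFactors (f m) (y m)) :=
    KolyvaginH44.smul_kolyvaginPoint_eq_of_mem_localInertia (W := W) hK ι σ
      (fun k ↦ k.primeFactors) H f y π j hj' e ρ hρ hπρ' m v hmv 𝔐 h𝔐
  -- the abstract class IS the concrete class `c_M(m)`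
  have hPt : (d m hm).toGeomPoints (d m hm).derivedPoint ∈
      invPoints (absoluteGaloisGroup K) (d m hm).pointsSubgroup ((p ^ M : ℕ) : ℤ) := by
    have h := hPt'
    rw [hP m hm, (hdict m hm).1] at h
    exact h
  have hc : (d m hm).kolyvaginClass hp M =
      kolyvaginClass (W.baseChange K) ((p ^ M : ℕ) : ℤ) hdiv hA'
        (j m (kolyvaginPoint (σ m) m.primeFactors (f m) (y m))) hPt' := by
    rw [KolyvaginHeegnerData.kolyvaginClass_of_admissible _ hp M (hA m hm) hPt]
    exact KolyvaginH44.kolyvaginClass_congr (by rw [(hdict m hm).1]; rfl) (hP m hm).symm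
  rw [hc]
  -- Gross Prop. 6.2 (1) by the reduction type of `E/K` at `v`
  by_cases hgood : (W.baseChange K).HasGoodReductionAt v
  · -- good `v`: Milne *ADT* I.3.8 for `E` itself (x11b3-p1's leaf), no receptacle clause
    exact kolyvaginClass_mem_selmerLocalKer_of_inertia_of_hasGoodReductionAt (W.baseChange K) hA'
      hPt' v hgood h𝔐 hI'
  -- bad `v`: the `E⁰(K̄_v)`-receptacle END
  have hm' : ∀ {ℓ : ℕ}, ℓ ∈ m.primeFactors → m / ℓ ∣ n := fun hℓ ↦
    (Nat.div_dvd_of_dvd (Nat.dvd_of_mem_primeFactors hℓ)).trans hm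
  have hle : ∀ {ℓ : ℕ}, ℓ ∈ m.primeFactors → ringClassField K ι (m / ℓ) ≤ ringClassField K ι m :=
    fun hℓ ↦ ringClassField_mono hK ι (Nat.div_dvd_of_dvd (Nat.dvd_of_mem_primeFactors hℓ)) hm0
  -- `E′_m`: generated by the `𝒢_m`-orbits of `y(m)` and of the `y(m/ℓ)↑` read in `E(K[m])`
  set S : Set ((W.baseChange (ringClassField K ι m)).toAffine.Point) :=
    {x | ∃ γ : ringClassGal ι m, x = γ • (d m hm).y ∨ ∃ (ℓ : ℕ) (hℓ : ℓ ∈ m.primeFactors),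
      x = γ • WeierstrassCurve.Affine.Point.map (W' := W)
        ((RingClassField.inclusion ι (hle hℓ)).restrictScalars ℚ) (d (m / ℓ) (hm' hℓ)).y}
    with hSdef
  have hSstab : ∀ (g : ringClassGal ι m), ∀ s ∈ S, g • s ∈ S := by
    rintro g s ⟨γ, h | ⟨ℓ, hℓ, h⟩⟩
    · refine ⟨g * γ, Or.inl ?_⟩
      rw [h]; exact (mul_smul g γ _).symm
    · refine ⟨g * γ, Or.inr ⟨ℓ, hℓ, ?_⟩⟩
      rw [h]; exact (mul_smul g γ _).symm
  have hyS : y m ∈ S := by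
    rw [(hdict m hm).2.1]; exact ⟨1, Or.inl (one_smul _ _).symm⟩
  have hzS : ∀ (ℓ : ℕ) (hℓ : ℓ ∈ m.primeFactors),
      WeierstrassCurve.Affine.Point.map (W' := W)
        ((RingClassField.inclusion ι (hle hℓ)).restrictScalars ℚ) (d (m / ℓ) (hm' hℓ)).y ∈ S :=
    fun ℓ hℓ ↦ ⟨1, Or.inr ⟨ℓ, hℓ, (one_smul _ _).symm⟩⟩
  -- the receptacle clause on the generators, from `hGZ`
  have hrecS : ∀ s ∈ S, n' • pointsMap (W.baseChange K) (v.adicCompletion K) (j m s) ∈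
      E0Receptacle (W.baseChange K) v := by
    rintro s ⟨γ, h | ⟨ℓ, hℓ, h⟩⟩
    · rw [h, (hdict m hm).1, hsmul]
      exact (hGZ m hm γ γ.2 v hgood).1
    · rw [h, (hdict m hm).1, hsmul]
      exact (hGZ m hm γ γ.2 v hgood).2 ℓ hℓ (hle hℓ)
  -- `Tr_ℓ y(m) = a_ℓ · y(m/ℓ)↑` with `p^M ∣ a_ℓ` ((β2) + (3.3), x11b3-p4's route, witness kept)
  have htr : ∀ ℓ ∈ m.primeFactors,
      grAct ((W.baseChange (ringClassField K ι m)).toAffine.Point) (traceElt (σ m ℓ) ℓ) (y m) ∈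
        (AddSubgroup.closure S).map (zsmulAddGroupHom ((p ^ M : ℕ) : ℤ) :
          (W.baseChange (ringClassField K ι m)).toAffine.Point →+ _) := by
    intro ℓ hℓ
    obtain ⟨hℓp, hℓm, -⟩ := Nat.mem_primeFactors.mp hℓ
    obtain ⟨hℓK, hℓM⟩ := hkol ℓ (Nat.primeFactors_mono hm hn0 hℓ)
    have hℓm' : ¬ ℓ ∣ m / ℓ :=
      KolyvaginH44.not_dvd_div_of_squarefree_of_prime (hn.squarefree_of_dvd hm) hℓp hℓm
    have hNm : Nat.Coprime N m := KolyvaginH37Bridge.coprime_of_forall_not_dvd hm0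
      fun q hq ↦ (hkol q (Nat.primeFactors_mono hm hn0 hq)).1.2.1
    haveI : Fact ℓ.Prime := ⟨hℓp⟩
    -- (β2): Gross Prop. 3.7 (1) for the tree's data, `a_ℓ = W.frobeniusTrace ℓ` currency
    have hgoodℓ : W.HasGoodReductionAtPrime ℓ :=
      KolyvaginH37Bridge.hasGoodReductionAtPrime_of_modularParametrizationData Dt hℓK.2.1
    have hrelE := HeegnerTrace.frobeniusTrace_smul_eq_of_lFunction_smul_eq hgoodℓ
      (HeegnerTrace.sum_pow_pointGalHom_y_eq_lFunction_smul_map hK ι hND hℓ hℓK.2.2.2.2.1 hℓK.2.1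
        hℓm' hNm (Or.inr hD) (d m hm) (d (m / ℓ) (hm' hℓ)) (hle hℓ))
    -- in `A₀ m = E(K[m])` with the `𝒢_m`-action: `Tr_ℓ y(m) = a_ℓ • y(m/ℓ)↑`
    have hrel : grAct ((W.baseChange (ringClassField K ι m)).toAffine.Point)
        (traceElt (σ m ℓ) ℓ) (y m) = W.frobeniusTrace ℓ •
          WeierstrassCurve.Affine.Point.map (W' := W)
            ((RingClassField.inclusion ι (hle hℓ)).restrictScalars ℚ) (d (m / ℓ) (hm' hℓ)).y := by
      rw [grAct_traceElt, ← hrelE, (hdict m hm).2.1]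
      refine Finset.sum_congr rfl fun i _ ↦ ?_
      rw [hsmul, Subgroup.coe_pow, (hdict m hm).2.2.1 ℓ hℓ]
    -- (3.3): `p^M ∣ a_ℓ`
    have haℓ : ((p ^ M : ℕ) : ℤ) ∣ W.frobeniusTrace ℓ := by
      have h := ((Zhang2014.le_kolyvaginIndex_iff (W := W) (p := p) (M := M) (ℓ := ℓ)).mp hℓM).2
      exact_mod_cast h
    obtain ⟨k, hk⟩ := haℓ
    refine AddSubgroup.mem_map.mpr ⟨k • WeierstrassCurve.Affine.Point.map (W' := W)
        ((RingClassField.inclusion ι (hle hℓ)).restrictScalars ℚ) (d (m / ℓ) (hm' hℓ)).y,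
      AddSubgroup.zsmul_mem _ (AddSubgroup.subset_closure (hzS ℓ hℓ)) k, ?_⟩
    rw [zsmulAddGroupHom_apply, smul_smul, ← hk, hrel]
  -- the abstract END at the bad place `v`
  exact kolyvaginClass_kolyvaginPoint_mem_selmerLocalKer_of_GZ31_E0 (W.baseChange K) (hfsec m)
    hgen (hord m) hdvd (π m) (j m) (hj' m) hA' hPt' v h𝔐 hI'
    (E' := AddSubgroup.closure S) (n' := n')
    ⟨fun γ e he ↦ smul_mem_closure_of_forall_smul_mem hSstab γ he,
      AddSubgroup.subset_closure hyS, htr,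
      fun x hx ↦ zsmul_map_mem_of_mem_closure
        ((pointsMap (W.baseChange K) (v.adicCompletion K)).comp (j m))
        (E0Receptacle (W.baseChange K) v) n' hrecS hx⟩
    hcop


omit [NumberField K] in
/-- A square-free `c` lies in a prime `𝔳` of `𝓞 K` only if one of its prime factors does. [folklore] -/
theorem exists_primeFactor_mem_of_natCast_mem {c : ℕ} (hc : Squarefree c) (𝔳 : HeightOneSpectrum (𝓞 K))
    (h : (c : 𝓞 K) ∈ 𝔳.asIdeal) : ∃ ℓ ∈ c.primeFactors, (ℓ : 𝓞 K) ∈ 𝔳.asIdeal := by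
  rw [← Nat.prod_primeFactors_of_squarefree hc, Nat.cast_prod] at h
  haveI := 𝔳.isPrime
  exact Ideal.IsPrime.prod_mem_iff.mp h

/-- **The Kummer part of `hκsel` (input of `JET.tamagawaExponent_le_mInfty_of_rowData`), modulo
[GZ86 III (3.1)]**, in the `H63` binder's currency: for `E/ℚ` globally minimal with `ρ̄_{E,p}` onto at an
odd `p`, `K` imaginary quadratic with `d_K ∉ {−3, −4}` and the Heegner hypothesis for `N = N_E`, a frame
`(Dt, β, ι)`, a conductor `c ∈ Λ` whose prime factors have index `≥ k`, and ANY datum `d` of conductor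
`c`: at every place `v` of `K` NOT over a prime factor of `c` (the index set of the Kummer clause of
`Jetchev2008.modifiedSelmerGroup`), `loc_v c_k(c) ∈ H¹_Kum(K_v, E[p^k])`
(`(W.baseChange K).kummerSelmerStructure (p^k) v`). Complex places: `H¹(ℂ, ·) = 0`; finite places:
`hloc_concrete_of_GZ31_zhang` read through `comap_localization_kummerSelmerStructure`. GIVEN: `hGZ` =
[GZ86 III (3.1)] in the receptacle form for every datum (and every pair datum at `m`, datum at `m/ℓ`),
an integer `n′` prime to `p` carrying it (printed `n′ = #E(ℚ)_tors`), and the two Gross §3 CM facts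
(`phi_heegnerPointOfConductor_mem_range_map_ringClassField`, `exists_generator_ringClassGalOver`) making
data exist at the divisors of `c`. [cite: GrossLMS1991, §6 Prop. 6.2 (1)] [cite: GrossZagier1986,
III (3.1)] [cite: Jetchev2008, §3.3.1/§3.4.1 (p. 816), Prop. 4.6 (p. 820)] -/
theorem localization_kolyvaginClass_mem_kummerSelmerStructure_of_GZ31 [W.IsElliptic] [W.IsGloballyMinimal]
    [NeZero (W.conductorNorm ℤ)]
    (hCM1 : phi_heegnerPointOfConductor_mem_range_map_ringClassField (W.conductorNorm ℤ) W K)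
    (hCM2 : exists_generator_ringClassGalOver K)
    (hK : IsImaginaryQuadratic K) (hD3 : NumberField.discr K ≠ -3) (hD4 : NumberField.discr K ≠ -4)
    (hH : SatisfiesHeegnerHypothesis (W.conductorNorm ℤ) K)
    {p : ℕ} [Fact p.Prime] (hp2 : p ≠ 2) (hρ : W.HasSurjectiveModNGaloisRep p)
    (Dt : ModularParametrizationData W (W.conductorNorm ℤ)) (β : ℤ) (ι : K →+* ℂ)
    {n' : ℤ} (hcop' : IsCoprime (p : ℤ) n')
    (hGZ : ∀ (m : ℕ) (dm : KolyvaginHeegnerData Dt β ι m)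
      (γ : ringClassField K ι m ≃ₐ[ℚ] ringClassField K ι m), γ ∈ ringClassGal ι m →
      ∀ v : HeightOneSpectrum (𝓞 K), ¬ (W.baseChange K).HasGoodReductionAt v →
        n' • pointsMap (W.baseChange K) (v.adicCompletion K)
            (dm.toGeomPoints (pointGalHom W (ringClassField K ι m) γ dm.y)) ∈
          E0Receptacle (W.baseChange K) v ∧
        ∀ (ℓ : ℕ), ℓ ∈ m.primeFactors → ∀ (dm' : KolyvaginHeegnerData Dt β ι (m / ℓ))
          (hle : ringClassField K ι (m / ℓ) ≤ ringClassField K ι m),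
          n' • pointsMap (W.baseChange K) (v.adicCompletion K)
              (dm.toGeomPoints (pointGalHom W (ringClassField K ι m) γ
                (WeierstrassCurve.Affine.Point.map (W' := W)
                  ((RingClassField.inclusion ι hle).restrictScalars ℚ) dm'.y))) ∈
            E0Receptacle (W.baseChange K) v)
    {c : ℕ} (hc : Squarefree c) {k : ℕ}
    (hcK : ∀ ℓ ∈ c.primeFactors, Zhang2014.IsKolyvaginPrime (W.conductorNorm ℤ) W K p ℓ ∧
      k ≤ Zhang2014.kolyvaginIndex W p ℓ)
    (d : KolyvaginHeegnerData Dt β ι c) [∀ j : ℕ, NumberField (ringClassField K ι j)]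
    (v : Place K) (hv : ∀ ℓ ∈ c.primeFactors, ¬ Jetchev2008.PlaceOver K v ℓ) :
    galoisCohomology.localization ((W.baseChange K).torsionGaloisModule ((p ^ k : ℕ) : ℤ)) v 1
        (d.kolyvaginClass (Fact.out : p.Prime) k) ∈
      (W.baseChange K).kummerSelmerStructure ((p ^ k : ℕ) : ℤ) v := by
  have hp : p.Prime := Fact.out
  rcases v with w | 𝔳
  · -- complex place: `H¹(ℂ, ·) = 0`
    haveI : IsTotallyComplex K := hK.2
    have hw : w.IsComplex := IsTotallyComplex.isComplex w
    have htop := GlobalDuality.addSubgroup_galoisCohomology_inl_eq_top_of_isComplex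
      ((W.baseChange K).torsionGaloisModule ((p ^ k : ℕ) : ℤ)) hw
      ((W.baseChange K).kummerSelmerStructure ((p ^ k : ℕ) : ℤ) (Sum.inl w))
    rw [htop]
    exact AddSubgroup.mem_top _
  · -- finite place `𝔳 ∤ c`
    have hcv : (c : 𝓞 K) ∉ 𝔳.asIdeal := fun h ↦ by
      obtain ⟨ℓ, hℓ, hℓv⟩ := exists_primeFactor_mem_of_natCast_mem hc 𝔳 h
      exact hv ℓ hℓ ⟨𝔳, rfl, hℓv⟩
    have hND : IsCoprime (W.conductorNorm ℤ : ℤ) (NumberField.discr K) :=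
      KolyvaginAssembly.isCoprime_discr_of_satisfiesHeegnerHypothesis hK hH
    have hD : NumberField.discr K < -4 := KolyvaginAssembly.discr_lt_neg_four hK ⟨hD3, hD4⟩
    have hinert : ∀ (m' : ℕ), m' ∣ c → ∀ q ∈ m'.primeFactors, (Ideal.span {(q : 𝓞 K)}).IsPrime :=
      fun m' hm' q hq ↦ (hcK q (Nat.primeFactors_mono hm' hc.ne_zero hq)).1.2.2.2.2.1
    -- data at every divisor of `c` (the given `d` at `c` itself)
    have hne : ∀ m' : ℕ, m' ∣ c → Nonempty (KolyvaginHeegnerData Dt β ι m') := fun m' hm' ↦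
      BirchSwinnertonDyer.Theorems.nonempty_kolyvaginHeegnerData_of_grossCM hCM1 hCM2 hK hH Dt β ι
        d.dvd_sq_sub (hc.squarefree_of_dvd hm') (hinert m' hm')
    let data : (m' : ℕ) → m' ∣ c → KolyvaginHeegnerData Dt β ι m' := fun m' hm' ↦
      if h : m' = c then h ▸ d else (hne m' hm').some
    have hdata : data c dvd_rfl = d := by simp [data]
    have hcop : IsCoprime ((p ^ k : ℕ) : ℤ) n' := by
      rw [Nat.cast_pow]; exact IsCoprime.pow_left hcop'
    have h := hloc_concrete_of_GZ31_zhang hK ι hp Dt hND hD hc hcK data hcop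
      (fun m hm γ hγ v hbad ↦ ⟨(hGZ m (data m hm) γ hγ v hbad).1,
        fun ℓ hℓ hle ↦ (hGZ m (data m hm) γ hγ v hbad).2 ℓ hℓ _ hle⟩)
      (fun m hm ↦ RingClassNoTorsion.isAdmissible_pointsSubgroup _ hK
        (ne_zero_of_dvd_ne_zero hc.ne_zero hm) hp hp2 hρ k) c dvd_rfl 𝔳 hcv
    rw [hdata] at h
    rw [← AddSubgroup.mem_comap, (W.baseChange K).comap_localization_kummerSelmerStructure]
    exact h

end Summit.BirchSwinnertonDyer.Rank1Residual.JET

end
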